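import Summits.QuantumFields.YangMills.Theorems.BalabanUVNodesN11NoExpansionStepSpecificationOfCoercive
import Summits.QuantumFields.YangMills.Theorems.BalabanUVNodesN11ThmP245OfSect3SupplyCoPH
import Summits.QuantumFields.YangMills.Theorems.BalabanUVNodesN11Sect3SupplyPresentParents
import Summits.QuantumFields.YangMills.Theorems.BalabanUVNodesN11Sect3SupplySplice

/-!
# DAG node N11 — `NoExpansionTStepAt θ p k` AND THEOREM 1 OF [III] AT A GENERIC STAGE-13 PARAMETER FROM COERCIVITY OF THE RESIDUAL's `quad`:
# the coercive twins of dag-n11-e's `noExpansionTStepAt_of_rows_at_present_parents` ∕ `sLaw₁₃CoPH_all_of_rows_of_supply_of_liveSel`, with the K0b binder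
# «∀ S ∈ admS, ∀ j, ∃ ŵ measurable, ∫⁻ ŵ ≠ ⊤, …» replaced by ONE pointwise row on the VALUE of `quad` ([I]'s positivity of `𝒬_j`), in the operand-rows and in the
# term-rows (def-T) grammars

HEADER — WORK-UNIT METADATA.  Cell `pub-ymgap`, YM-PLAN Track A (HUMAN RULING D-0062 ∕ D-0149), WIDTH SEAT `pub-ymgap-dag-n11-w4` (g0) on NODE n11 [B14]; route
`BalabanUVNodes` rev 25, item K1⁷ `StabilityBAtRecordR13SepCoPH` = stmt-QuantumFields-20542 (helper, `--kind proof --supports 20542 --as helper`, count-neutral).  dag-n11-e g15's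
HAND-OUT «w4 take Z» (bus 2026-08-27T23:43:44Z).  [III] = [Balaban1988Convergent], [I] = [Balaban1987RG1], [IV] = [Balaban1989LargeFieldI].  Over this seat's p586051 (ed. 2:
`exists_local_witness_clause_succ_of_sLaw₁₃CoPH_of_coercive` ∕ `…_of_coercive_of_termRows`), dag-n11-e's p576857 (`NoExpansionTStepAt`, `Sect3SupplyAt`), p578897
(`sLaw₁₃CoPH_all_of_tStep_of_supply_of_liveSel`), p580585 (`slotsTOfRecord₁₃H_succ_eq_zero_of_init_eq_zero`: absent parents give the zero disjunct) and p586169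
(`Sect3SpliceSupplyAt`, `sLaw₁₃CoPH_all_of_tStep_of_spliceSupply_of_liveSel`).

WHAT THIS FILE PROVES (0 `sorry`, 0 `def`).  §1 ★★ `noExpansionTStepAt_of_coercive_rows_at_present_parents` — at a GENERIC `θ` (core provisos, `ZhUnity`, `k < K`, `1 ≤ M`)
dag-n11-e's predicate `NoExpansionTStepAt θ p k` from, for every `k`-local exposed witness of `ρ_k`'s §2 form and every no-expansion history with a PRESENT parent: the four pins
(P), (V), `quad_k(∅) = 0`, `k`-locality of `quad_j(Λ_{j+1})`; measurability of `ζ0 ∕ quad`; COERCIVITY «∀ j, ∃ c > 0, ∀ ω, c·Σ_{b ∈ bondsIn j (Λᶜ_{j+1}∩Ω_{j+1})(init s′)}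
‖(ω j).2 b‖² ≤ quad_j(Λ_{j+1}(init s′))(ω)»; the operand rows.  ★★ `noExpansionTStepAt_of_coercive_termRows_at_present_parents` — the same with the operand rows replaced by
def-T's six term rows (measurable ∕ uniformly bounded term values at the embedded background; def-R's background-map row proved in p585753).  §2 ★★★
`sLaw₁₃CoPH_all_of_coercive_rows_of_supply_of_liveSel` · ★★★ `sLaw₁₃CoPH_all_of_coercive_termRows_of_supply_of_liveSel` — THEOREM 1 of [III] (`∀ k ≤ K, SLaw₁₃CoPH θ p k`)
at a generic `θ` on the live-selector line from (per level) those rows AND [III] §3's supply `Sect3SupplyAt θ p k`; ★★★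
`sLaw₁₃CoPH_all_of_coercive_termRows_of_spliceSupply_of_liveSel` — the same with the supply in dag-n11-e's minimal SPLICE form `Sect3SpliceSupplyAt θ p k` (p586169).  So the
hand-over list to node00-def-K0b now READS AS THEOREM 1 from [I]'s positivity of `𝒬_j` (plus the pins, measurability, def-T's term rows and §3's supply) — no `∃ ŵ` anywhere.

HONEST FRAMING.  Helper lane of K1⁷; count-neutral kernel composition of accepted theorems; rows and supply DISPLAYED ([I]'s positivity of `𝒬_j`, def-T's term laws, [III]
§3 ∕ Thm 2 — nobody's theorem in the tree); nothing of Bałaban asserted; the binder over exposed witnesses is dag-n11-e's grammar (the residual rows do not read the witness; the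
operand ∕ term rows do).  N11 NOT discharged; K1⁷ NOT closed; counts unmoved (typed 28∕28 · discharged 5∕27).  One finite four-torus programme at fixed `ε = L^{−K}`; R4 closes
only the conditional finite-𝕋⁴ rung `BalabanLadder.UV` — NOT ℝ⁴, NOT OS, NOT a mass gap, NOT Clay.  No `sorry`, `axiom`, `def`, `instance`, `notation`.
Sources (SHAPE only): [III] Theorem p.245, Thm 1 p.262, p.244, (2.12) p.256, (2.17)–(2.18) p.257, (2.20)–(2.27) pp.258–259, (2.31) p.260, (2.41) p.261, (3.1) p.264,
(3.16)–(3.21) pp.268–269, (3.23)–(3.25) p.270, §3 p.279; [IV] (0.2)–(0.4) p.176, p.177 (i)–(ii); [I] (1.4)–(1.5) pp.260–261, (2.11) p.267.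
-/

noncomputable section

open MeasureTheory
open scoped BigOperators ENNReal NNReal Matrix.Norms.L2Operator

namespace Summit.QuantumFields.YangMills.Theorems.BalabanUVNodesN11NoExpansionTStepOfCoercive

open Literature.MathematicalPhysics.QuantumFieldTheory.Balaban1983to89 T4Continuum Node00 Node00.Tk
open B15DeterminingSets (MSField)
open B10Eq42TorusConstraint (bondsIn)
open BalabanUVNodesN11FluctTruncationDefs (IsFluctLocal)
open BalabanUVNodesN11NoExpansionStepSpecificationOfCoercive (exists_local_witness_clause_succ_of_sLaw₁₃CoPH_of_coercive
  exists_local_witness_clause_succ_of_sLaw₁₃CoPH_of_coercive_of_termRows)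
open BalabanUVNodesN11Sect3SupplyDefs (NoExpansionTStepAt Sect3SupplyAt)
open BalabanUVNodesN11Sect3SupplyPresentParents (slotsTOfRecord₁₃H_succ_eq_zero_of_init_eq_zero)
open BalabanUVNodesN11ThmP245OfSect3SupplyCoPH (sLaw₁₃CoPH_all_of_tStep_of_supply_of_liveSel)
open BalabanUVNodesN11Sect3SupplySpliceDefs (Sect3SpliceSupplyAt)
open BalabanUVNodesN11Sect3SupplySplice (sLaw₁₃CoPH_all_of_tStep_of_spliceSupply_of_liveSel)

variable {F : T4Family} {N : ℕ} [NeZero N]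
variable (θ : Stage13HParams F N) (p : B12.RunParams)

/-! ## §1  `NoExpansionTStepAt θ p k` at a generic `θ` from the coercive row lists -/

/-- **★★ `NoExpansionTStepAt θ p k` AT A GENERIC STAGE-13 PARAMETER FROM THE COERCIVE ROW LIST** (one application of this seat's p586051
`exists_local_witness_clause_succ_of_sLaw₁₃CoPH_of_coercive`; core provisos, `ZhUnity`, `k < K`, `1 ≤ M`): the rows — (P) prefix agreement, (V) the generation-`k` pin,
`quad_k(∅) = 0`, `k`-locality of `quad_j(Λ_{j+1})`, measurability of `ζ0 ∕ quad` of the residual serving `s′`, COERCIVITY of `quad_j(Λ_{j+1})` on the A-fibre (one `c_j > 0` per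
generation; [I]'s positivity of `𝒬_j`), and the operand measurability ∕ bound of the witness — asked for EVERY `k`-local exposed witness, at every no-expansion history with a
PRESENT parent (absent parents: zero disjunct, p580585).  Rows DISPLAYED, nothing of them discharged here; twin of dag-n11-e's `noExpansionTStepAt_of_rows_at_present_parents`
with the K0b binder «∃ ŵ …» replaced by the pointwise row. [cite: Balaban1988Convergent, Theorem p.245, Thm 1 p.262, (3.24)–(3.25) p.270, (3.1) p.264, (2.18) p.257, (2.20)–(2.23) p.258, (3.16)–(3.21) pp.268–269; Balaban1989LargeFieldI, (0.2)–(0.3) p.176; Balaban1987RG1, (2.11) p.267 (shape of the row)] -/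
theorem noExpansionTStepAt_of_coercive_rows_at_present_parents (h : θ.Provisos₁₃CoPH F N) (hU : θ.ZhUnity F N) {k : ℕ} (hk : k < p.K) (hM : 1 ≤ θ.τ9.M)
    (hrows : ∀ (t : SeqOfRecord F θ.ν θ.τ9.M (gOfRecord₁₃ F N θ.toStage13Params p) p.K k → Sect2.TermValues (F.P p.K) (MatA N) (FluctV N) θ.τ9.M)
      (Ek : SeqOfRecord F θ.ν θ.τ9.M (gOfRecord₁₃ F N θ.toStage13Params p) p.K k → ℝ),
      HasSect2FormAtZS F N (FluctV N) p.K (settingOfRecord₁₃ F N θ.toStage13Params p) k (θ.rzAt p) (WtOfRecord₁₃H F N θ p)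
        (UbgOfRecord₁₃CoP F N θ.toStage13Params p k)
        (fun s u => Sect2.LawsRT (sect2TowerOfRecord F N (FluctV N) p.K (settingOfRecord₁₃ F N θ.toStage13Params p) (θ.rzAt p s) s u)
          (settingOfRecord₁₃ F N θ.toStage13Params p).lf k)
        (slotsOfRecord F N θ.ν θ.τ9 (EOfRecord₁₃ F N θ.toStage13Params) (wOfRecord₉ F N θ.toStage9Params) θ.ppSel p (gOfRecord₁₃ F N θ.toStage13Params p) k) t Ek →
      (∀ s₀, IsFluctLocal k (t s₀)) →
      ∀ s : SeqOfRecord F θ.ν θ.τ9.M (gOfRecord₁₃ F N θ.toStage13Params p) p.K (k + 1), s.Ω (k + 1) = ∅ →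
        slotsOfRecord F N θ.ν θ.τ9 (EOfRecord₁₃ F N θ.toStage13Params) (wOfRecord₉ F N θ.toStage9Params) θ.ppSel p (gOfRecord₁₃ F N θ.toStage13Params p) k s.init ≠ 0 →
        -- the four pins of the general step: (P), (V), `quad_k(∅) = 0`, `k`-locality of `quad_j(Λ_{j+1})`
        (∀ j, j < k → (θ.zhAt p s).ζ0 j = (θ.zhAt p s.init).ζ0 j ∧ (θ.zhAt p s).quad j = (θ.zhAt p s.init).quad j) ∧
        (∀ (V' : GaugeField (F.P p.K) (k + 1) (SU N)) (U₀ : GaugeField (F.P p.K) k (SU N)),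
          (θ.zhAt p s).ζ0 k Set.univ (pairCfgAt (V := FluctV N) k V' U₀) =
            chiSeqOfRecord F N θ.ν θ.τ9.M (gOfRecord₁₃ F N θ.toStage13Params p) p.K k s.init U₀ *
              wOfRecord₉ F N θ.toStage9Params p (gOfRecord₁₃ F N θ.toStage13Params p) k s U₀ ((avOfRecord F N p.K k).avg U₀)) ∧
        (∀ (V' : GaugeField (F.P p.K) (k + 1) (SU N)) (U₀ : GaugeField (F.P p.K) k (SU N)), (θ.zhAt p s).quad k ∅ (pairCfgAt (V := FluctV N) k V' U₀) = 0) ∧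
        (∀ j, j < k → ∀ ω ω' : MultiCfg (F.P p.K) (SU N) (FluctV N), (∀ i, i ≤ k → ω i = ω' i) →
          (θ.zhAt p s).quad j (s.init.Λ (j + 1)) ω = (θ.zhAt p s).quad j (s.init.Λ (j + 1)) ω') ∧
        -- measurability of the residual serving `s′`
        (∀ j (Y : Set (Site (F.P p.K) 0)), Measurable ((θ.zhAt p s).ζ0 j Y)) ∧
        (∀ j (Λ' : Set (Site (F.P p.K) 0)), Measurable ((θ.zhAt p s).quad j Λ')) ∧
        -- COERCIVITY of `quad_j(Λ_{j+1})` on the A-fibre ([I]'s positivity of `𝒬_j`)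
        (∀ j : ℕ, ∃ c : ℝ, 0 < c ∧ ∀ ω : MultiCfg (F.P p.K) (SU N) (FluctV N),
          c * ∑ b ∈ (Set.toFinite (bondsIn j ((s.init.Λ (j + 1))ᶜ ∩ s.init.Ω (j + 1)))).toFinset, ‖(ω j).2 b‖ ^ 2 ≤
            (θ.zhAt p s).quad j (s.init.Λ (j + 1)) ω) ∧
        -- the operand rows of the witness (def-T ∕ def-R)
        (∀ S ∈ admSOfRecord F θ.ν θ.τ9.M (gOfRecord₁₃ F N θ.toStage13Params p) p.K k s.init,
          Measurable (fun ω : MultiCfg (F.P p.K) (SU N) (FluctV N) =>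
            sect2Operand F N (FluctV N) p.K (settingOfRecord₁₃ F N θ.toStage13Params p) (θ.rzAt p s.init) s.init (t s.init) (Ek s.init)
                (UbgOfRecord₁₃CoP F N θ.toStage13Params p k s.init) (S, fun j => (ω j).2) (fun j => (ω j).1)) ∧
          ∃ CΦ : ℝ, ∀ a U, sect2Operand F N (FluctV N) p.K (settingOfRecord₁₃ F N θ.toStage13Params p) (θ.rzAt p s.init) s.init (t s.init) (Ek s.init)
                (UbgOfRecord₁₃CoP F N θ.toStage13Params p k s.init) a U ≤ CΦ)) :
    NoExpansionTStepAt θ p k := by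
  intro hS
  obtain ⟨t, Ek, hform, hloc, hstep⟩ := exists_local_witness_clause_succ_of_sLaw₁₃CoPH_of_coercive θ p h hU hk hM hS
  refine ⟨t, Ek, hform, fun s hΩ => ?_⟩
  by_cases h0 : slotsOfRecord F N θ.ν θ.τ9 (EOfRecord₁₃ F N θ.toStage13Params) (wOfRecord₉ F N θ.toStage9Params) θ.ppSel p (gOfRecord₁₃ F N θ.toStage13Params p) k s.init = 0
  · exact Or.inl (slotsTOfRecord₁₃H_succ_eq_zero_of_init_eq_zero θ p s h0)
  · obtain ⟨hpre, hZ, hq, hqloc, hζm, hqm, hcoer, hΦ⟩ := hrows t Ek hform hloc s hΩ h0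
    exact hstep s hΩ hpre hZ hq hqloc hζm hqm hcoer hΦ

/-- **★★ `NoExpansionTStepAt θ p k` AT A GENERIC STAGE-13 PARAMETER FROM THE COERCIVE ROW LIST IN def-T's TERM-ROWS GRAMMAR** (one application of p586051 ed. 2
`exists_local_witness_clause_succ_of_sLaw₁₃CoPH_of_coercive_of_termRows`): as above with the operand rows replaced by def-T's six term rows — `U ↦ Re 𝐄^{(j)}(X, ι U, z)`,
`U ↦ Re 𝐑^{(j)}(X, ι U)` measurable, `(U, A) ↦ Re 𝐁^{(j)}(X, ι U, (S′, A))` jointly measurable, and uniform bounds `C_E ∕ C_R ∕ C_B` at the embedded background — for the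
exposed witness at the parent history (def-R's background-map measurability is proved inside, p585753). [cite: Balaban1988Convergent, Theorem p.245, Thm 1 p.262, (2.12) p.256, (2.18) p.257, (2.23)–(2.27) pp.258–259, (2.31) p.260, (2.41) p.261, (3.24)–(3.25) p.270; Balaban1989LargeFieldI, (0.2)–(0.3) p.176; Balaban1987RG1, (2.11) p.267 (shape)] -/
theorem noExpansionTStepAt_of_coercive_termRows_at_present_parents (h : θ.Provisos₁₃CoPH F N) (hU : θ.ZhUnity F N) {k : ℕ} (hk : k < p.K) (hM : 1 ≤ θ.τ9.M)
    (hrows : ∀ (t : SeqOfRecord F θ.ν θ.τ9.M (gOfRecord₁₃ F N θ.toStage13Params p) p.K k → Sect2.TermValues (F.P p.K) (MatA N) (FluctV N) θ.τ9.M)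
      (Ek : SeqOfRecord F θ.ν θ.τ9.M (gOfRecord₁₃ F N θ.toStage13Params p) p.K k → ℝ),
      HasSect2FormAtZS F N (FluctV N) p.K (settingOfRecord₁₃ F N θ.toStage13Params p) k (θ.rzAt p) (WtOfRecord₁₃H F N θ p)
        (UbgOfRecord₁₃CoP F N θ.toStage13Params p k)
        (fun s u => Sect2.LawsRT (sect2TowerOfRecord F N (FluctV N) p.K (settingOfRecord₁₃ F N θ.toStage13Params p) (θ.rzAt p s) s u)
          (settingOfRecord₁₃ F N θ.toStage13Params p).lf k)
        (slotsOfRecord F N θ.ν θ.τ9 (EOfRecord₁₃ F N θ.toStage13Params) (wOfRecord₉ F N θ.toStage9Params) θ.ppSel p (gOfRecord₁₃ F N θ.toStage13Params p) k) t Ek →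
      (∀ s₀, IsFluctLocal k (t s₀)) →
      ∀ s : SeqOfRecord F θ.ν θ.τ9.M (gOfRecord₁₃ F N θ.toStage13Params p) p.K (k + 1), s.Ω (k + 1) = ∅ →
        slotsOfRecord F N θ.ν θ.τ9 (EOfRecord₁₃ F N θ.toStage13Params) (wOfRecord₉ F N θ.toStage9Params) θ.ppSel p (gOfRecord₁₃ F N θ.toStage13Params p) k s.init ≠ 0 →
        -- the four pins of the general step: (P), (V), `quad_k(∅) = 0`, `k`-locality of `quad_j(Λ_{j+1})`
        (∀ j, j < k → (θ.zhAt p s).ζ0 j = (θ.zhAt p s.init).ζ0 j ∧ (θ.zhAt p s).quad j = (θ.zhAt p s.init).quad j) ∧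
        (∀ (V' : GaugeField (F.P p.K) (k + 1) (SU N)) (U₀ : GaugeField (F.P p.K) k (SU N)),
          (θ.zhAt p s).ζ0 k Set.univ (pairCfgAt (V := FluctV N) k V' U₀) =
            chiSeqOfRecord F N θ.ν θ.τ9.M (gOfRecord₁₃ F N θ.toStage13Params p) p.K k s.init U₀ *
              wOfRecord₉ F N θ.toStage9Params p (gOfRecord₁₃ F N θ.toStage13Params p) k s U₀ ((avOfRecord F N p.K k).avg U₀)) ∧
        (∀ (V' : GaugeField (F.P p.K) (k + 1) (SU N)) (U₀ : GaugeField (F.P p.K) k (SU N)), (θ.zhAt p s).quad k ∅ (pairCfgAt (V := FluctV N) k V' U₀) = 0) ∧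
        (∀ j, j < k → ∀ ω ω' : MultiCfg (F.P p.K) (SU N) (FluctV N), (∀ i, i ≤ k → ω i = ω' i) →
          (θ.zhAt p s).quad j (s.init.Λ (j + 1)) ω = (θ.zhAt p s).quad j (s.init.Λ (j + 1)) ω') ∧
        -- measurability of the residual serving `s′`
        (∀ j (Y : Set (Site (F.P p.K) 0)), Measurable ((θ.zhAt p s).ζ0 j Y)) ∧
        (∀ j (Λ' : Set (Site (F.P p.K) 0)), Measurable ((θ.zhAt p s).quad j Λ')) ∧
        -- COERCIVITY of `quad_j(Λ_{j+1})` on the A-fibre ([I]'s positivity of `𝒬_j`)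
        (∀ j : ℕ, ∃ c : ℝ, 0 < c ∧ ∀ ω : MultiCfg (F.P p.K) (SU N) (FluctV N),
          c * ∑ b ∈ (Set.toFinite (bondsIn j ((s.init.Λ (j + 1))ᶜ ∩ s.init.Ω (j + 1)))).toFinset, ‖(ω j).2 b‖ ^ 2 ≤
            (θ.zhAt p s).quad j (s.init.Λ (j + 1)) ω) ∧
        -- def-T: the six term rows of the exposed witness at the parent history, READ AT THE EMBEDDED BACKGROUND
        (∀ (j : ℕ) (X : (Sect2.domSys (F.P p.K) θ.τ9.M j).Dom) (z : Site (F.P p.K) j) (g' : ℝ),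
          Measurable (fun U : GaugeField (F.P p.K) 0 (SU N) => ((t s.init).E j X z g' (Sect2.ofBackgroundC (settingOfRecord₁₃ F N θ.toStage13Params p).ι U)).re)) ∧
        (∀ (j : ℕ) (X : (Sect2.domSys (F.P p.K) θ.τ9.M j).Dom),
          Measurable (fun U : GaugeField (F.P p.K) 0 (SU N) => ((t s.init).R j X (Sect2.ofBackgroundC (settingOfRecord₁₃ F N θ.toStage13Params p).ι U)).re)) ∧
        (∀ (S' : ℕ → Set (Site (F.P p.K) 0)) (j : ℕ) (X : (Sect2.domSys (F.P p.K) θ.τ9.M j).Dom),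
          Measurable (fun q : GaugeField (F.P p.K) 0 (SU N) × MSFluct (F.P p.K) (FluctV N) =>
            ((t s.init).B j X (Sect2.ofBackgroundC (settingOfRecord₁₃ F N θ.toStage13Params p).ι q.1) (S', q.2)).re)) ∧
        (∃ CE : ℝ, ∀ (j : ℕ) (X : (Sect2.domSys (F.P p.K) θ.τ9.M j).Dom) (z : Site (F.P p.K) j) (g' : ℝ) (U : GaugeField (F.P p.K) 0 (SU N)),
          |((t s.init).E j X z g' (Sect2.ofBackgroundC (settingOfRecord₁₃ F N θ.toStage13Params p).ι U)).re| ≤ CE) ∧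
        (∃ CR : ℝ, ∀ (j : ℕ) (X : (Sect2.domSys (F.P p.K) θ.τ9.M j).Dom) (U : GaugeField (F.P p.K) 0 (SU N)),
          |((t s.init).R j X (Sect2.ofBackgroundC (settingOfRecord₁₃ F N θ.toStage13Params p).ι U)).re| ≤ CR) ∧
        (∃ CB : ℝ, ∀ (j : ℕ) (X : (Sect2.domSys (F.P p.K) θ.τ9.M j).Dom) (U : GaugeField (F.P p.K) 0 (SU N)) (a : Tk.SFluct (F.P p.K) (FluctV N)),
          |((t s.init).B j X (Sect2.ofBackgroundC (settingOfRecord₁₃ F N θ.toStage13Params p).ι U) a).re| ≤ CB)) :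
    NoExpansionTStepAt θ p k := by
  intro hS
  obtain ⟨t, Ek, hform, hloc, hstep⟩ := exists_local_witness_clause_succ_of_sLaw₁₃CoPH_of_coercive_of_termRows θ p h hU hk hM hS
  refine ⟨t, Ek, hform, fun s hΩ => ?_⟩
  by_cases h0 : slotsOfRecord F N θ.ν θ.τ9 (EOfRecord₁₃ F N θ.toStage13Params) (wOfRecord₉ F N θ.toStage9Params) θ.ppSel p (gOfRecord₁₃ F N θ.toStage13Params p) k s.init = 0
  · exact Or.inl (slotsTOfRecord₁₃H_succ_eq_zero_of_init_eq_zero θ p s h0)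
  · obtain ⟨hpre, hZ, hq, hqloc, hζm, hqm, hcoer, hE, hR, hB, hEb, hRb, hBb⟩ := hrows t Ek hform hloc s hΩ h0
    exact hstep s hΩ hpre hZ hq hqloc hζm hqm hcoer hE hR hB hEb hRb hBb

/-! ## §2  THEOREM 1 of [III] at a generic `θ` on the live line from the coercive row lists and [III] §3's supply -/

/-- **★★★ THEOREM 1 OF [III] AT A GENERIC STAGE-13 PARAMETER `θ`, ALL LEVELS, ON THE LIVE-SELECTOR LINE — FROM (per level, at the no-expansion histories with a PRESENT parent,
for every `k`-local exposed witness) THE COERCIVE ROW LIST AND [III] §3's SUPPLY**: §1's first theorem fed into dag-n11-e's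
`…ThmP245OfSect3SupplyCoPH.sLaw₁₃CoPH_all_of_tStep_of_supply_of_liveSel` (core provisos, `ZhUnity`, selector clause, admissibility, `0 ≤ κ, E₀, B₀`, `1 ≤ M`).  Rows and supply
DISPLAYED; twin of dag-n11-e's `sLaw₁₃CoPH_all_of_rows_of_supply_of_liveSel` with the K0b binder «∃ ŵ …» replaced by the pointwise coercivity row.
[cite: Balaban1988Convergent, Thm 1 p.262, Theorem p.245, p.244, (3.24)–(3.25) p.270, (3.23) p.270, §3 p.279; Balaban1989LargeFieldI, (0.2)–(0.4) p.176, p.177 (i)–(ii); Balaban1987RG1, (2.11) p.267 (shape)] -/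
theorem sLaw₁₃CoPH_all_of_coercive_rows_of_supply_of_liveSel (h : θ.Provisos₁₃CoPH F N) (hU : θ.ZhUnity F N)
    (hsel : θ.ppSel = ppSelLiveOfRecord F N θ.ν θ.τ9 (EOfRecord₁₃ F N θ.toStage13Params) (wOfRecord₉ F N θ.toStage9Params))
    (hθ : θ.Admissible F N) (hκ : 0 ≤ θ.s2.lf.κ) (hE₀ : 0 ≤ θ.s2.lf.E₀) (hB₀ : 0 ≤ θ.s2.lf.B₀) (hM : 1 ≤ θ.τ9.M)
    (hrows : ∀ k, k < p.K → ∀ (t : SeqOfRecord F θ.ν θ.τ9.M (gOfRecord₁₃ F N θ.toStage13Params p) p.K k → Sect2.TermValues (F.P p.K) (MatA N) (FluctV N) θ.τ9.M)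
        (Ek : SeqOfRecord F θ.ν θ.τ9.M (gOfRecord₁₃ F N θ.toStage13Params p) p.K k → ℝ),
        HasSect2FormAtZS F N (FluctV N) p.K (settingOfRecord₁₃ F N θ.toStage13Params p) k (θ.rzAt p) (WtOfRecord₁₃H F N θ p)
          (UbgOfRecord₁₃CoP F N θ.toStage13Params p k)
          (fun s u => Sect2.LawsRT (sect2TowerOfRecord F N (FluctV N) p.K (settingOfRecord₁₃ F N θ.toStage13Params p) (θ.rzAt p s) s u)
            (settingOfRecord₁₃ F N θ.toStage13Params p).lf k)
          (slotsOfRecord F N θ.ν θ.τ9 (EOfRecord₁₃ F N θ.toStage13Params) (wOfRecord₉ F N θ.toStage9Params) θ.ppSel p (gOfRecord₁₃ F N θ.toStage13Params p) k) t Ek →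
        (∀ s₀, IsFluctLocal k (t s₀)) →
        ∀ s : SeqOfRecord F θ.ν θ.τ9.M (gOfRecord₁₃ F N θ.toStage13Params p) p.K (k + 1), s.Ω (k + 1) = ∅ →
          slotsOfRecord F N θ.ν θ.τ9 (EOfRecord₁₃ F N θ.toStage13Params) (wOfRecord₉ F N θ.toStage9Params) θ.ppSel p (gOfRecord₁₃ F N θ.toStage13Params p) k s.init ≠ 0 →
          (∀ j, j < k → (θ.zhAt p s).ζ0 j = (θ.zhAt p s.init).ζ0 j ∧ (θ.zhAt p s).quad j = (θ.zhAt p s.init).quad j) ∧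
          (∀ (V' : GaugeField (F.P p.K) (k + 1) (SU N)) (U₀ : GaugeField (F.P p.K) k (SU N)),
            (θ.zhAt p s).ζ0 k Set.univ (pairCfgAt (V := FluctV N) k V' U₀) =
              chiSeqOfRecord F N θ.ν θ.τ9.M (gOfRecord₁₃ F N θ.toStage13Params p) p.K k s.init U₀ *
                wOfRecord₉ F N θ.toStage9Params p (gOfRecord₁₃ F N θ.toStage13Params p) k s U₀ ((avOfRecord F N p.K k).avg U₀)) ∧
          (∀ (V' : GaugeField (F.P p.K) (k + 1) (SU N)) (U₀ : GaugeField (F.P p.K) k (SU N)), (θ.zhAt p s).quad k ∅ (pairCfgAt (V := FluctV N) k V' U₀) = 0) ∧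
          (∀ j, j < k → ∀ ω ω' : MultiCfg (F.P p.K) (SU N) (FluctV N), (∀ i, i ≤ k → ω i = ω' i) →
            (θ.zhAt p s).quad j (s.init.Λ (j + 1)) ω = (θ.zhAt p s).quad j (s.init.Λ (j + 1)) ω') ∧
          (∀ j (Y : Set (Site (F.P p.K) 0)), Measurable ((θ.zhAt p s).ζ0 j Y)) ∧
          (∀ j (Λ' : Set (Site (F.P p.K) 0)), Measurable ((θ.zhAt p s).quad j Λ')) ∧
          (∀ j : ℕ, ∃ c : ℝ, 0 < c ∧ ∀ ω : MultiCfg (F.P p.K) (SU N) (FluctV N),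
            c * ∑ b ∈ (Set.toFinite (bondsIn j ((s.init.Λ (j + 1))ᶜ ∩ s.init.Ω (j + 1)))).toFinset, ‖(ω j).2 b‖ ^ 2 ≤
              (θ.zhAt p s).quad j (s.init.Λ (j + 1)) ω) ∧
          (∀ S ∈ admSOfRecord F θ.ν θ.τ9.M (gOfRecord₁₃ F N θ.toStage13Params p) p.K k s.init,
            Measurable (fun ω : MultiCfg (F.P p.K) (SU N) (FluctV N) =>
              sect2Operand F N (FluctV N) p.K (settingOfRecord₁₃ F N θ.toStage13Params p) (θ.rzAt p s.init) s.init (t s.init) (Ek s.init)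
                  (UbgOfRecord₁₃CoP F N θ.toStage13Params p k s.init) (S, fun j => (ω j).2) (fun j => (ω j).1)) ∧
            ∃ CΦ : ℝ, ∀ a U, sect2Operand F N (FluctV N) p.K (settingOfRecord₁₃ F N θ.toStage13Params p) (θ.rzAt p s.init) s.init (t s.init) (Ek s.init)
                  (UbgOfRecord₁₃CoP F N θ.toStage13Params p k s.init) a U ≤ CΦ))
    (hsup : ∀ k, k < p.K → Sect3SupplyAt θ p k) :
    ∀ k, k ≤ p.K → SLaw₁₃CoPH F N θ p k :=
  sLaw₁₃CoPH_all_of_tStep_of_supply_of_liveSel θ p h hsel hθ hκ hE₀ hB₀ hM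
    (fun k hk => noExpansionTStepAt_of_coercive_rows_at_present_parents θ p h hU hk hM (hrows k hk)) hsup

/-- **★★★ THEOREM 1 OF [III] AT A GENERIC `θ` ON THE LIVE LINE FROM THE COERCIVE ROW LIST IN def-T's TERM-ROWS GRAMMAR AND [III] §3's SUPPLY** (§1's second theorem fed
into `sLaw₁₃CoPH_all_of_tStep_of_supply_of_liveSel`): `∀ k ≤ K, SLaw₁₃CoPH θ p k` from (per level `k < K`, at the no-expansion histories with a PRESENT parent, for every
`k`-local exposed witness) the pins (P) ∕ (V) ∕ `quad_k(∅) = 0` ∕ locality, measurability of `ζ0 ∕ quad`, COERCIVITY of `quad_j(Λ_{j+1})` ([I]'s positivity of `𝒬_j`), def-T's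
six term rows, and `Sect3SupplyAt θ p k` — the hand-over list to node00-def-K0b ∕ def-T read as THEOREM 1, with no `∃ ŵ` anywhere.
[cite: Balaban1988Convergent, Thm 1 p.262, Theorem p.245, p.244, (2.12) p.256, (2.23)–(2.27) pp.258–259, (2.31) p.260, (2.41) p.261, (3.24)–(3.25) p.270, §3 p.279; Balaban1989LargeFieldI, (0.2)–(0.4) p.176, p.177 (i)–(ii); Balaban1987RG1, (2.11) p.267 (shape)] -/
theorem sLaw₁₃CoPH_all_of_coercive_termRows_of_supply_of_liveSel (h : θ.Provisos₁₃CoPH F N) (hU : θ.ZhUnity F N)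
    (hsel : θ.ppSel = ppSelLiveOfRecord F N θ.ν θ.τ9 (EOfRecord₁₃ F N θ.toStage13Params) (wOfRecord₉ F N θ.toStage9Params))
    (hθ : θ.Admissible F N) (hκ : 0 ≤ θ.s2.lf.κ) (hE₀ : 0 ≤ θ.s2.lf.E₀) (hB₀ : 0 ≤ θ.s2.lf.B₀) (hM : 1 ≤ θ.τ9.M)
    (hrows : ∀ k, k < p.K → ∀ (t : SeqOfRecord F θ.ν θ.τ9.M (gOfRecord₁₃ F N θ.toStage13Params p) p.K k → Sect2.TermValues (F.P p.K) (MatA N) (FluctV N) θ.τ9.M)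
        (Ek : SeqOfRecord F θ.ν θ.τ9.M (gOfRecord₁₃ F N θ.toStage13Params p) p.K k → ℝ),
        HasSect2FormAtZS F N (FluctV N) p.K (settingOfRecord₁₃ F N θ.toStage13Params p) k (θ.rzAt p) (WtOfRecord₁₃H F N θ p)
          (UbgOfRecord₁₃CoP F N θ.toStage13Params p k)
          (fun s u => Sect2.LawsRT (sect2TowerOfRecord F N (FluctV N) p.K (settingOfRecord₁₃ F N θ.toStage13Params p) (θ.rzAt p s) s u)
            (settingOfRecord₁₃ F N θ.toStage13Params p).lf k)
          (slotsOfRecord F N θ.ν θ.τ9 (EOfRecord₁₃ F N θ.toStage13Params) (wOfRecord₉ F N θ.toStage9Params) θ.ppSel p (gOfRecord₁₃ F N θ.toStage13Params p) k) t Ek →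
        (∀ s₀, IsFluctLocal k (t s₀)) →
        ∀ s : SeqOfRecord F θ.ν θ.τ9.M (gOfRecord₁₃ F N θ.toStage13Params p) p.K (k + 1), s.Ω (k + 1) = ∅ →
          slotsOfRecord F N θ.ν θ.τ9 (EOfRecord₁₃ F N θ.toStage13Params) (wOfRecord₉ F N θ.toStage9Params) θ.ppSel p (gOfRecord₁₃ F N θ.toStage13Params p) k s.init ≠ 0 →
          (∀ j, j < k → (θ.zhAt p s).ζ0 j = (θ.zhAt p s.init).ζ0 j ∧ (θ.zhAt p s).quad j = (θ.zhAt p s.init).quad j) ∧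
          (∀ (V' : GaugeField (F.P p.K) (k + 1) (SU N)) (U₀ : GaugeField (F.P p.K) k (SU N)),
            (θ.zhAt p s).ζ0 k Set.univ (pairCfgAt (V := FluctV N) k V' U₀) =
              chiSeqOfRecord F N θ.ν θ.τ9.M (gOfRecord₁₃ F N θ.toStage13Params p) p.K k s.init U₀ *
                wOfRecord₉ F N θ.toStage9Params p (gOfRecord₁₃ F N θ.toStage13Params p) k s U₀ ((avOfRecord F N p.K k).avg U₀)) ∧
          (∀ (V' : GaugeField (F.P p.K) (k + 1) (SU N)) (U₀ : GaugeField (F.P p.K) k (SU N)), (θ.zhAt p s).quad k ∅ (pairCfgAt (V := FluctV N) k V' U₀) = 0) ∧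
          (∀ j, j < k → ∀ ω ω' : MultiCfg (F.P p.K) (SU N) (FluctV N), (∀ i, i ≤ k → ω i = ω' i) →
            (θ.zhAt p s).quad j (s.init.Λ (j + 1)) ω = (θ.zhAt p s).quad j (s.init.Λ (j + 1)) ω') ∧
          (∀ j (Y : Set (Site (F.P p.K) 0)), Measurable ((θ.zhAt p s).ζ0 j Y)) ∧
          (∀ j (Λ' : Set (Site (F.P p.K) 0)), Measurable ((θ.zhAt p s).quad j Λ')) ∧
          (∀ j : ℕ, ∃ c : ℝ, 0 < c ∧ ∀ ω : MultiCfg (F.P p.K) (SU N) (FluctV N),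
            c * ∑ b ∈ (Set.toFinite (bondsIn j ((s.init.Λ (j + 1))ᶜ ∩ s.init.Ω (j + 1)))).toFinset, ‖(ω j).2 b‖ ^ 2 ≤
              (θ.zhAt p s).quad j (s.init.Λ (j + 1)) ω) ∧
          (∀ (j : ℕ) (X : (Sect2.domSys (F.P p.K) θ.τ9.M j).Dom) (z : Site (F.P p.K) j) (g' : ℝ),
            Measurable (fun U : GaugeField (F.P p.K) 0 (SU N) => ((t s.init).E j X z g' (Sect2.ofBackgroundC (settingOfRecord₁₃ F N θ.toStage13Params p).ι U)).re)) ∧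
          (∀ (j : ℕ) (X : (Sect2.domSys (F.P p.K) θ.τ9.M j).Dom),
            Measurable (fun U : GaugeField (F.P p.K) 0 (SU N) => ((t s.init).R j X (Sect2.ofBackgroundC (settingOfRecord₁₃ F N θ.toStage13Params p).ι U)).re)) ∧
          (∀ (S' : ℕ → Set (Site (F.P p.K) 0)) (j : ℕ) (X : (Sect2.domSys (F.P p.K) θ.τ9.M j).Dom),
            Measurable (fun q : GaugeField (F.P p.K) 0 (SU N) × MSFluct (F.P p.K) (FluctV N) =>
              ((t s.init).B j X (Sect2.ofBackgroundC (settingOfRecord₁₃ F N θ.toStage13Params p).ι q.1) (S', q.2)).re)) ∧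
          (∃ CE : ℝ, ∀ (j : ℕ) (X : (Sect2.domSys (F.P p.K) θ.τ9.M j).Dom) (z : Site (F.P p.K) j) (g' : ℝ) (U : GaugeField (F.P p.K) 0 (SU N)),
            |((t s.init).E j X z g' (Sect2.ofBackgroundC (settingOfRecord₁₃ F N θ.toStage13Params p).ι U)).re| ≤ CE) ∧
          (∃ CR : ℝ, ∀ (j : ℕ) (X : (Sect2.domSys (F.P p.K) θ.τ9.M j).Dom) (U : GaugeField (F.P p.K) 0 (SU N)),
            |((t s.init).R j X (Sect2.ofBackgroundC (settingOfRecord₁₃ F N θ.toStage13Params p).ι U)).re| ≤ CR) ∧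
          (∃ CB : ℝ, ∀ (j : ℕ) (X : (Sect2.domSys (F.P p.K) θ.τ9.M j).Dom) (U : GaugeField (F.P p.K) 0 (SU N)) (a : Tk.SFluct (F.P p.K) (FluctV N)),
            |((t s.init).B j X (Sect2.ofBackgroundC (settingOfRecord₁₃ F N θ.toStage13Params p).ι U) a).re| ≤ CB))
    (hsup : ∀ k, k < p.K → Sect3SupplyAt θ p k) :
    ∀ k, k ≤ p.K → SLaw₁₃CoPH F N θ p k :=
  sLaw₁₃CoPH_all_of_tStep_of_supply_of_liveSel θ p h hsel hθ hκ hE₀ hB₀ hM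
    (fun k hk => noExpansionTStepAt_of_coercive_termRows_at_present_parents θ p h hU hk hM (hrows k hk)) hsup

/-- **★★★ … WITH [III] §3's SUPPLY IN dag-n11-e's MINIMAL (SPLICE) FORM**: the preceding theorem with `Sect3SupplyAt θ p k` replaced by `Sect3SpliceSupplyAt θ p k` ((O1) for
`k ≥ 2`, [III] Thm 2's clauses for the supplier's own new terms, the 𝐓-image identity at expansion children of present parents), through dag-n11-e's p586169
`sLaw₁₃CoPH_all_of_tStep_of_spliceSupply_of_liveSel`.  THEOREM 1 at a generic `θ` on the live line then reads from: the pins, measurability, COERCIVITY of `quad`, def-T's six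
term rows, and the splice supply — the three owners' lists (node00-def-K0b, node00-def-T, the §3 supplier) and nothing else.
[cite: Balaban1988Convergent, Thm 1 p.262, Theorem p.245, Thm 2 p.263, (3.67) p.283, (3.24)–(3.25) p.270, §3 p.279; Balaban1989LargeFieldI, (0.2)–(0.4) p.176; Balaban1987RG1, (2.11) p.267 (shape)] -/
theorem sLaw₁₃CoPH_all_of_coercive_termRows_of_spliceSupply_of_liveSel (h : θ.Provisos₁₃CoPH F N) (hU : θ.ZhUnity F N)
    (hsel : θ.ppSel = ppSelLiveOfRecord F N θ.ν θ.τ9 (EOfRecord₁₃ F N θ.toStage13Params) (wOfRecord₉ F N θ.toStage9Params))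
    (hθ : θ.Admissible F N) (hκ : 0 ≤ θ.s2.lf.κ) (hE₀ : 0 ≤ θ.s2.lf.E₀) (hB₀ : 0 ≤ θ.s2.lf.B₀) (hM : 1 ≤ θ.τ9.M)
    (hrows : ∀ k, k < p.K → ∀ (t : SeqOfRecord F θ.ν θ.τ9.M (gOfRecord₁₃ F N θ.toStage13Params p) p.K k → Sect2.TermValues (F.P p.K) (MatA N) (FluctV N) θ.τ9.M)
        (Ek : SeqOfRecord F θ.ν θ.τ9.M (gOfRecord₁₃ F N θ.toStage13Params p) p.K k → ℝ),
        HasSect2FormAtZS F N (FluctV N) p.K (settingOfRecord₁₃ F N θ.toStage13Params p) k (θ.rzAt p) (WtOfRecord₁₃H F N θ p)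
          (UbgOfRecord₁₃CoP F N θ.toStage13Params p k)
          (fun s u => Sect2.LawsRT (sect2TowerOfRecord F N (FluctV N) p.K (settingOfRecord₁₃ F N θ.toStage13Params p) (θ.rzAt p s) s u)
            (settingOfRecord₁₃ F N θ.toStage13Params p).lf k)
          (slotsOfRecord F N θ.ν θ.τ9 (EOfRecord₁₃ F N θ.toStage13Params) (wOfRecord₉ F N θ.toStage9Params) θ.ppSel p (gOfRecord₁₃ F N θ.toStage13Params p) k) t Ek →
        (∀ s₀, IsFluctLocal k (t s₀)) →
        ∀ s : SeqOfRecord F θ.ν θ.τ9.M (gOfRecord₁₃ F N θ.toStage13Params p) p.K (k + 1), s.Ω (k + 1) = ∅ →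
          slotsOfRecord F N θ.ν θ.τ9 (EOfRecord₁₃ F N θ.toStage13Params) (wOfRecord₉ F N θ.toStage9Params) θ.ppSel p (gOfRecord₁₃ F N θ.toStage13Params p) k s.init ≠ 0 →
          (∀ j, j < k → (θ.zhAt p s).ζ0 j = (θ.zhAt p s.init).ζ0 j ∧ (θ.zhAt p s).quad j = (θ.zhAt p s.init).quad j) ∧
          (∀ (V' : GaugeField (F.P p.K) (k + 1) (SU N)) (U₀ : GaugeField (F.P p.K) k (SU N)),
            (θ.zhAt p s).ζ0 k Set.univ (pairCfgAt (V := FluctV N) k V' U₀) =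
              chiSeqOfRecord F N θ.ν θ.τ9.M (gOfRecord₁₃ F N θ.toStage13Params p) p.K k s.init U₀ *
                wOfRecord₉ F N θ.toStage9Params p (gOfRecord₁₃ F N θ.toStage13Params p) k s U₀ ((avOfRecord F N p.K k).avg U₀)) ∧
          (∀ (V' : GaugeField (F.P p.K) (k + 1) (SU N)) (U₀ : GaugeField (F.P p.K) k (SU N)), (θ.zhAt p s).quad k ∅ (pairCfgAt (V := FluctV N) k V' U₀) = 0) ∧
          (∀ j, j < k → ∀ ω ω' : MultiCfg (F.P p.K) (SU N) (FluctV N), (∀ i, i ≤ k → ω i = ω' i) →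
            (θ.zhAt p s).quad j (s.init.Λ (j + 1)) ω = (θ.zhAt p s).quad j (s.init.Λ (j + 1)) ω') ∧
          (∀ j (Y : Set (Site (F.P p.K) 0)), Measurable ((θ.zhAt p s).ζ0 j Y)) ∧
          (∀ j (Λ' : Set (Site (F.P p.K) 0)), Measurable ((θ.zhAt p s).quad j Λ')) ∧
          (∀ j : ℕ, ∃ c : ℝ, 0 < c ∧ ∀ ω : MultiCfg (F.P p.K) (SU N) (FluctV N),
            c * ∑ b ∈ (Set.toFinite (bondsIn j ((s.init.Λ (j + 1))ᶜ ∩ s.init.Ω (j + 1)))).toFinset, ‖(ω j).2 b‖ ^ 2 ≤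
              (θ.zhAt p s).quad j (s.init.Λ (j + 1)) ω) ∧
          (∀ (j : ℕ) (X : (Sect2.domSys (F.P p.K) θ.τ9.M j).Dom) (z : Site (F.P p.K) j) (g' : ℝ),
            Measurable (fun U : GaugeField (F.P p.K) 0 (SU N) => ((t s.init).E j X z g' (Sect2.ofBackgroundC (settingOfRecord₁₃ F N θ.toStage13Params p).ι U)).re)) ∧
          (∀ (j : ℕ) (X : (Sect2.domSys (F.P p.K) θ.τ9.M j).Dom),
            Measurable (fun U : GaugeField (F.P p.K) 0 (SU N) => ((t s.init).R j X (Sect2.ofBackgroundC (settingOfRecord₁₃ F N θ.toStage13Params p).ι U)).re)) ∧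
          (∀ (S' : ℕ → Set (Site (F.P p.K) 0)) (j : ℕ) (X : (Sect2.domSys (F.P p.K) θ.τ9.M j).Dom),
            Measurable (fun q : GaugeField (F.P p.K) 0 (SU N) × MSFluct (F.P p.K) (FluctV N) =>
              ((t s.init).B j X (Sect2.ofBackgroundC (settingOfRecord₁₃ F N θ.toStage13Params p).ι q.1) (S', q.2)).re)) ∧
          (∃ CE : ℝ, ∀ (j : ℕ) (X : (Sect2.domSys (F.P p.K) θ.τ9.M j).Dom) (z : Site (F.P p.K) j) (g' : ℝ) (U : GaugeField (F.P p.K) 0 (SU N)),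
            |((t s.init).E j X z g' (Sect2.ofBackgroundC (settingOfRecord₁₃ F N θ.toStage13Params p).ι U)).re| ≤ CE) ∧
          (∃ CR : ℝ, ∀ (j : ℕ) (X : (Sect2.domSys (F.P p.K) θ.τ9.M j).Dom) (U : GaugeField (F.P p.K) 0 (SU N)),
            |((t s.init).R j X (Sect2.ofBackgroundC (settingOfRecord₁₃ F N θ.toStage13Params p).ι U)).re| ≤ CR) ∧
          (∃ CB : ℝ, ∀ (j : ℕ) (X : (Sect2.domSys (F.P p.K) θ.τ9.M j).Dom) (U : GaugeField (F.P p.K) 0 (SU N)) (a : Tk.SFluct (F.P p.K) (FluctV N)),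
            |((t s.init).B j X (Sect2.ofBackgroundC (settingOfRecord₁₃ F N θ.toStage13Params p).ι U) a).re| ≤ CB))
    (hsup : ∀ k, k < p.K → Sect3SpliceSupplyAt θ p k) :
    ∀ k, k ≤ p.K → SLaw₁₃CoPH F N θ p k :=
  sLaw₁₃CoPH_all_of_tStep_of_spliceSupply_of_liveSel θ p h hsel hθ hκ hE₀ hB₀ hM
    (fun k hk => noExpansionTStepAt_of_coercive_termRows_at_present_parents θ p h hU hk hM (hrows k hk)) hsup

end Summit.QuantumFields.YangMills.Theorems.BalabanUVNodesN11NoExpansionTStepOfCoercive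

end
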